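import Mathlib

/-!
# Passive dressing by a whole conservative chain (kernel #227, lemmaR-A5 §28)

Solo-blind programme, session s89.  Kernels #225/#226 treat one chain mode; here the slow amplitude
`u` is coupled (read-out weight `B`, injection weight `δ`, fast factor `w(t)`) to the first mode of a
finite chain `y : Fin n → ℝ` whose internal dynamics is DAMPING `-Λ_i(t)` plus a CONSERVATIVE coupling
`w(t) c_i(t)` with `Σ_i y_i c_i = 0` (for the staggered-phase Gegenbauer roll chain, `c = K y` with `K`
antisymmetric — `antisymm_coupling_conservative`).  With `E = u² + (B/δ) Σ_i y_i²`:
  `(e^{-2A} E)' = -e^{-2A} (2B/δ) Σ_i (Λ_i + α) y_i²`,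
so if every chain mode out-decays the slow one (`Λ_i ≥ -α`) the dressed slow mode is dominated by the
bare one with constant one — for any number of modes and any fast factor.

* `antisymm_coupling_conservative` — `Σ_i y_i (K y)_i = 0` for antisymmetric `K`;
* `chain_energy_hasDerivAt` — the exact derivative;
* `chain_energy_antitone`, `chain_dressing_bound` — passivity and dressed ≤ bare.
-/

namespace Summit.AnomalousDissipation.AnomalousDissipation.Theorems

open Finset

/-- An antisymmetric coupling is conservative: `Σ_i y_i (Σ_j K_ij y_j) = 0`. -/
theorem antisymm_coupling_conservative {n : ℕ} (K : Fin n → Fin n → ℝ) (y : Fin n → ℝ)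
    (hK : ∀ i j, K i j = -K j i) :
    ∑ i, y i * ∑ j, K i j * y j = 0 := by
  have h1 : ∑ i, y i * ∑ j, K i j * y j = ∑ i, ∑ j, y i * K i j * y j := by
    refine sum_congr rfl fun i _ => ?_
    rw [mul_sum]
    refine sum_congr rfl fun j _ => ?_
    ring
  have h2 : ∑ i, ∑ j, y i * K i j * y j = ∑ i, ∑ j, y j * K j i * y i := sum_comm
  have h3 : ∑ i, ∑ j, y j * K j i * y i = -∑ i, ∑ j, y i * K i j * y j := by
    rw [← sum_neg_distrib]
    refine sum_congr rfl fun i _ => ?_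
    rw [← sum_neg_distrib]
    refine sum_congr rfl fun j _ => ?_
    rw [hK j i]
    ring
  have : ∑ i, ∑ j, y i * K i j * y j = 0 := by linarith
  rw [h1, this]

/-- Evaluation of the chain's energy production: damping, conservative coupling, injection. -/
theorem chain_sum_eval {n : ℕ} (Y Λv cv : Fin n → ℝ) (wt δ ut : ℝ) (i₀ : Fin n) :
    ∑ i, ((-Λv i * Y i + wt * cv i + δ * wt * ut * (if i = i₀ then 1 else 0)) * Y i
        + Y i * (-Λv i * Y i + wt * cv i + δ * wt * ut * (if i = i₀ then 1 else 0)))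
      = -2 * ∑ i, Λv i * (Y i * Y i) + 2 * wt * ∑ i, Y i * cv i + 2 * δ * wt * ut * Y i₀ := by
  have e1 : ∀ i, ((-Λv i * Y i + wt * cv i + δ * wt * ut * (if i = i₀ then 1 else 0)) * Y i
      + Y i * (-Λv i * Y i + wt * cv i + δ * wt * ut * (if i = i₀ then 1 else 0)))
      = -2 * (Λv i * (Y i * Y i)) + 2 * wt * (Y i * cv i)
        + 2 * δ * wt * ut * (if i = i₀ then Y i else 0) := fun i => by
    split_ifs <;> ring
  simp_rw [e1]
  rw [sum_add_distrib, sum_add_distrib, ← mul_sum, ← mul_sum, ← mul_sum, Finset.sum_ite_eq']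
  simp

/-- The chain-weighted energy `e^{-2A(t)} (u(t)² + (B/δ) Σ_i y_i(t)²)`. -/
noncomputable def chainEnergy {n : ℕ} (u A : ℝ → ℝ) (y : ℝ → Fin n → ℝ) (B δ : ℝ) (t : ℝ) : ℝ :=
  Real.exp (-2 * A t) * (u t * u t + B / δ * ∑ i, y t i * y t i)

/-- EXACT DERIVATIVE.  Slow mode `u' = α u - B w y_{i₀}`; chain `y_i' = -Λ_i y_i + w c_i + δ w u [i = i₀]`
with conservative coupling `Σ_i y_i c_i = 0`; `A' = α`; `δ ≠ 0`.  Then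
`(e^{-2A} E)' = -e^{-2A} (2B/δ) Σ_i (Λ_i + α) y_i²`. -/
theorem chain_energy_hasDerivAt {n : ℕ} (u α w A : ℝ → ℝ) (y Λ c : ℝ → Fin n → ℝ) (i₀ : Fin n)
    (B δ : ℝ) (hδ : δ ≠ 0) (t : ℝ)
    (hu : HasDerivAt u (α t * u t - B * w t * y t i₀) t)
    (hy : ∀ i, HasDerivAt (fun s => y s i)
      (-Λ t i * y t i + w t * c t i + δ * w t * u t * (if i = i₀ then 1 else 0)) t)
    (hc : ∑ i, y t i * c t i = 0)
    (hA : HasDerivAt A (α t) t) :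
    HasDerivAt (chainEnergy u A y B δ)
      (-(Real.exp (-2 * A t) * (2 * B / δ) * ∑ i, (Λ t i + α t) * (y t i * y t i))) t := by
  unfold chainEnergy
  have hE : HasDerivAt (fun s => Real.exp (-2 * A s)) (Real.exp (-2 * A t) * (-2 * α t)) t := by
    have h1 : HasDerivAt (fun s => -2 * A s) (-2 * α t) t := hA.const_mul (-2)
    exact h1.exp
  have hu2 := hu.mul hu
  have hS0 := HasDerivAt.sum (u := Finset.univ) fun i _ => (hy i).mul (hy i)
  have hS : HasDerivAt (fun s => ∑ i, y s i * y s i)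
      (∑ i, ((-Λ t i * y t i + w t * c t i + δ * w t * u t * (if i = i₀ then 1 else 0)) * y t i
        + y t i * (-Λ t i * y t i + w t * c t i + δ * w t * u t * (if i = i₀ then 1 else 0)))) t := by
    have hfun : (fun s => ∑ i, y s i * y s i) = ∑ i, ((fun s => y s i) * fun s => y s i) := by
      funext s; simp [Finset.sum_apply]
    rw [hfun]; exact hS0
  have hall := hE.mul (hu2.add (hS.const_mul (B / δ)))
  refine hall.congr_deriv ?_
  simp only [Pi.mul_apply, Pi.add_apply]
  rw [chain_sum_eval, hc]
  have hsplit : ∑ i, (Λ t i + α t) * (y t i * y t i)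
      = ∑ i, Λ t i * (y t i * y t i) + α t * ∑ i, y t i * y t i := by
    rw [mul_sum, ← sum_add_distrib]
    refine sum_congr rfl fun i _ => ?_
    ring
  rw [hsplit]
  field_simp
  ring

/-- PASSIVITY: if every chain mode out-decays the slow one (`Λ_i ≥ -α`), `B ≥ 0`, `δ > 0`, the
weighted energy is non-increasing. -/
theorem chain_energy_antitone {n : ℕ} (u α w A : ℝ → ℝ) (y Λ c : ℝ → Fin n → ℝ) (i₀ : Fin n)
    (B δ : ℝ) (hB : 0 ≤ B) (hδ : 0 < δ)
    (hu : ∀ t, HasDerivAt u (α t * u t - B * w t * y t i₀) t)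
    (hy : ∀ t i, HasDerivAt (fun s => y s i)
      (-Λ t i * y t i + w t * c t i + δ * w t * u t * (if i = i₀ then 1 else 0)) t)
    (hc : ∀ t, ∑ i, y t i * c t i = 0)
    (hA : ∀ t, HasDerivAt A (α t) t) (hgap : ∀ t i, -α t ≤ Λ t i) :
    Antitone (chainEnergy u A y B δ) := by
  have hd : ∀ t, HasDerivAt (chainEnergy u A y B δ)
      (-(Real.exp (-2 * A t) * (2 * B / δ) * ∑ i, (Λ t i + α t) * (y t i * y t i))) t :=
    fun t => chain_energy_hasDerivAt u α w A y Λ c i₀ B δ hδ.ne' t (hu t) (hy t) (hc t) (hA t)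
  refine antitone_of_deriv_nonpos (fun t => (hd t).differentiableAt) fun t => ?_
  rw [(hd t).deriv]
  have h1 : 0 ≤ Real.exp (-2 * A t) := (Real.exp_pos _).le
  have h2 : 0 ≤ 2 * B / δ := by positivity
  have h3 : 0 ≤ ∑ i, (Λ t i + α t) * (y t i * y t i) :=
    sum_nonneg fun i _ => mul_nonneg (by linarith [hgap t i]) (mul_self_nonneg _)
  have : 0 ≤ Real.exp (-2 * A t) * (2 * B / δ) * ∑ i, (Λ t i + α t) * (y t i * y t i) := by
    positivity
  linarith

/-- DRESSED ≤ BARE for the whole chain: along the resolvent column (`y(t') = 0`),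
`u(t)² ≤ e^{2(A(t) - A(t'))} u(t')²` for all `t ≥ t'`, any number of modes, any fast factor. -/
theorem chain_dressing_bound {n : ℕ} (u α w A : ℝ → ℝ) (y Λ c : ℝ → Fin n → ℝ) (i₀ : Fin n)
    (B δ : ℝ) (hB : 0 ≤ B) (hδ : 0 < δ)
    (hu : ∀ t, HasDerivAt u (α t * u t - B * w t * y t i₀) t)
    (hy : ∀ t i, HasDerivAt (fun s => y s i)
      (-Λ t i * y t i + w t * c t i + δ * w t * u t * (if i = i₀ then 1 else 0)) t)
    (hc : ∀ t, ∑ i, y t i * c t i = 0)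
    (hA : ∀ t, HasDerivAt A (α t) t) (hgap : ∀ t i, -α t ≤ Λ t i)
    (t' t : ℝ) (htt : t' ≤ t) (hy0 : y t' = 0) :
    u t ^ 2 ≤ Real.exp (2 * (A t - A t')) * u t' ^ 2 := by
  have hanti := chain_energy_antitone u α w A y Λ c i₀ B δ hB hδ hu hy hc hA hgap htt
  unfold chainEnergy at hanti
  simp only [hy0, Pi.zero_apply, mul_zero, sum_const_zero, add_zero] at hanti
  have hpos : 0 < Real.exp (-2 * A t) := Real.exp_pos _
  have hyt : 0 ≤ B / δ * ∑ i, y t i * y t i := by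
    have := sum_nonneg fun i (_ : i ∈ (Finset.univ : Finset (Fin n))) => mul_self_nonneg (y t i)
    positivity
  have h1 : Real.exp (-2 * A t) * u t ^ 2 ≤ Real.exp (-2 * A t') * u t' ^ 2 := by
    have : Real.exp (-2 * A t) * (u t * u t)
        ≤ Real.exp (-2 * A t) * (u t * u t + B / δ * ∑ i, y t i * y t i) :=
      mul_le_mul_of_nonneg_left (by linarith) hpos.le
    rw [sq, sq]
    linarith
  have e0 : Real.exp (2 * A t) * (Real.exp (-2 * A t) * u t ^ 2) = u t ^ 2 := by
    rw [← mul_assoc, ← Real.exp_add]; norm_num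
  have e1 : Real.exp (2 * A t) * (Real.exp (-2 * A t') * u t' ^ 2)
      = Real.exp (2 * (A t - A t')) * u t' ^ 2 := by
    rw [← mul_assoc, ← Real.exp_add]; ring_nf
  have h3 := mul_le_mul_of_nonneg_left h1 (Real.exp_pos (2 * A t)).le
  rwa [e0, e1] at h3

end Summit.AnomalousDissipation.AnomalousDissipation.Theorems
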